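import Summits.BirchSwinnertonDyer.BirchSwinnertonDyer.Theorems.AdditiveKolyvaginRoadKolyvaginPrimitiveOfLowerHalvesOverQ
import Literature.NumberTheory.EllipticCurves.Rank1Residual.Typed.Basic
import Literature.NumberTheory.EllipticCurves.RootNumber
import Literature.NumberTheory.EllipticCurves.SemistabilityDefect
import Literature.NumberTheory.EllipticCurves.ModularSymbols
import Literature.NumberTheory.EllipticCurves.BSDInvariants
import Literature.NumberTheory.EllipticCurves.GlobalMinimalModel
import HarnessLib

/-!
# Sketch — crux-ideate g19 (seat 2, round 1) on `AdditiveKolyvaginRoad.LevelKolyvaginSystemsAdditive`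
(stmt-BirchSwinnertonDyer-21396). First lemmas of the three idea cards, typed over existing
declarations; every `def` is a `Prop` (nothing asserted, nothing proved). BSD is not proved by this.

Residual of the crux (tree: `levelKolyvaginSystemsAdditive_of_lowerHalves`, p638284): the two LOWER
halves `Typed.MissingLowerBoundAt` over `ℚ` — LOW₀ at every non-CM additive analytic-rank-0 row `p ≥ 5`,
LOW₁ at every ♯ additive analytic-rank-1 row.

* §1 `RamifiedToricHabitat` — sign law of the `p`-RAMIFIED auxiliary habitat (card `ramified-toric-habitat`).
* §2 `KuriharaLowerHalf` — Kim–Nakamura's Kurihara-number criterion typed as an implication INTO the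
  socket predicate `Typed.MissingLowerBoundAt` (card `kurihara-lower-half`).
* §3 `DivisionTypeSlot` — the elementary arithmetic of the depth-zero type slot on the division algebra
  (card `division-type-slot`).
-/

noncomputable section

open scoped Classical

set_option linter.dupNamespace false

namespace Summit.BirchSwinnertonDyer.BirchSwinnertonDyer.Cruxes.LevelKolyvaginSystemsAdditive

open WeierstrassCurve Literature.NumberTheory.EllipticCurves
  Literature.NumberTheory.EllipticCurves.Rank1Residual
  Literature.NumberTheory.EllipticCurves.Rank1Residual.Typed
  Literature.NumberTheory.EllipticCurves.ModularForms

/-! ## §1 Ramified toric habitat -/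
namespace RamifiedToricHabitat

/-- «All the other bad primes split in `K′`» (Kronecker symbol `(d_{K′}/q) = 1`; at `q = 2`: `d ≡ 1 mod 8`). -/
def OtherBadPrimesSplit (W : WeierstrassCurve ℚ) (p : ℕ) (d : ℤ) : Prop :=
  ∀ q : ℕ, q.Prime → (q : ℤ) ∣ (W.conductorNorm ℤ : ℤ) → q ≠ p →
    (q ≠ 2 → jacobiSym d q = 1) ∧ (q = 2 → d % 8 = 1)

/-- FIRST LEMMA (card `ramified-toric-habitat`), supercuspidal branch. At an additive potentially good
prime `p ≥ 5` whose semistability defect `e` does NOT divide `p − 1` (non-abelian inertia, supercuspidal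
local type), for an imaginary quadratic `K′` in which `p` RAMIFIES and every other bad prime splits,
the sign of `E/K′` is `+1` WHATEVER `w(E/ℚ)` is: `w(E) · w(E^{(d_{K′})}) = +1`
(local dichotomy: `ε(BC_{K′_p} σ_p) = +1` for dihedral-unramified supercuspidal `σ_p` and ramified `K′_p`,
so the `χ = 1` toric functional lives on the DIVISION-ALGEBRA side at `p` (Tunnell–Saito); the definite
algebra `B_{p∞}` is the habitat of the analytic-rank-0 rows). -/
def SignLawSupercuspidal : Prop :=
  ∀ (W : WeierstrassCurve ℚ) [W.IsElliptic] [W.IsGloballyMinimal] (p : ℕ) [Fact p.Prime]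
    (K : Type) [Field K] [NumberField K],
    5 ≤ p → Addv W p → 1 < W.semistabilityDefectAt p → ¬ (W.semistabilityDefectAt p ∣ p - 1) →
    IsImaginaryQuadratic K → NumberField.discr K < -4 → (p : ℤ) ∣ NumberField.discr K →
    OtherBadPrimesSplit W p (NumberField.discr K) →
    W.rootNumber * (W.quadraticTwist (NumberField.discr K : ℚ)).rootNumber = 1

/-- Companion (principal-series branch, the falsifiable other half of the dichotomy): if instead the
defect `e > 1` DIVIDES `p − 1` (abelian inertia, ramified principal series incl. potentially
multiplicative `e = 2`), the same habitat has sign `−1`: `w(E) · w(E^{(d_{K′})}) = −1`. -/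
def SignLawPrincipalSeries : Prop :=
  ∀ (W : WeierstrassCurve ℚ) [W.IsElliptic] [W.IsGloballyMinimal] (p : ℕ) [Fact p.Prime]
    (K : Type) [Field K] [NumberField K],
    5 ≤ p → ¬ W.HasGoodReductionAtPrime p → 1 < W.semistabilityDefectAt p →
    W.semistabilityDefectAt p ∣ p - 1 →
    IsImaginaryQuadratic K → NumberField.discr K < -4 → (p : ℤ) ∣ NumberField.discr K →
    OtherBadPrimesSplit W p (NumberField.discr K) →
    W.rootNumber * (W.quadraticTwist (NumberField.discr K : ℚ)).rootNumber = -1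

end RamifiedToricHabitat

/-! ## §2 Kurihara road to the lower half LOW₀ -/
namespace KuriharaLowerHalf

/-- `n` is a squarefree product of Kurihara–Kolyvagin primes for `(E, p)`: every prime `ℓ ∣ n` has
`ℓ ∤ N p`, `ℓ ≡ 1 (mod p)` and `a_ℓ(E) ≡ ℓ + 1 (mod p)` (Kim–Nakamura §1.2). -/
def IsKuriharaLevel (W : WeierstrassCurve ℚ) [W.IsGloballyMinimal] (p n : ℕ) : Prop :=
  Squarefree n ∧ 1 < n ∧ ∀ ℓ ∈ n.primeFactors,
    ¬ (ℓ : ℤ) ∣ (W.conductorNorm ℤ : ℤ) ∧ ℓ ≠ p ∧ p ∣ ℓ - 1 ∧ (p : ℤ) ∣ W.frobeniusTrace ℓ - (ℓ + 1)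

/-- A system of discrete logarithms at the primes of `n`: `g ℓ` a primitive root mod `ℓ` and
`(g ℓ) ^ (dl ℓ a) = a` in `ZMod ℓ` for every `a` prime to `n`. -/
def IsDiscreteLogSystem (n : ℕ) (g : ℕ → ℕ) (dl : ℕ → ℕ → ℕ) : Prop :=
  ∀ ℓ ∈ n.primeFactors, IsPrimitiveRoot (g ℓ : ZMod ℓ) (ℓ - 1) ∧
    ∀ a : ℕ, Nat.Coprime a n → (g ℓ : ZMod ℓ) ^ (dl ℓ a) = (a : ZMod ℓ)

/-- The Kurihara number `δ_n = Σ_{a ∈ (ℤ/n)ˣ} [a/n]⁺ · ∏_{ℓ ∣ n} log_ℓ(a)` built from a plus modular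
symbol `ms : ℚ → ℚ` (`r ↦ [r]⁺`) and a discrete-log system (Kim–Nakamura §1.2; only its class mod `p`
is meaningful). -/
def kuriharaNumber (ms : ℚ → ℚ) (n : ℕ) (dl : ℕ → ℕ → ℕ) : ℚ :=
  ∑ a ∈ (Finset.range n).filter (fun a => Nat.Coprime a n),
    ms ((a : ℚ) / n) * ∏ ℓ ∈ n.primeFactors, (dl ℓ a : ℚ)

/-- FIRST LEMMA (card `kurihara-lower-half`): Kim–Nakamura, arXiv:1808.07726 Thm 1.7 (+ Rem. 1.8(1)),
typed as an implication INTO the socket predicate. For `E/ℚ` with ADDITIVE reduction at `p > 7`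
(`p ∈ {5, 7}` also, outside their exceptional congruence classes Ass. 2.5 — not typed here), `ρ̄_{E,p}`
onto, `p ∤ Tam(E) · ∏_{ℓ mult}(ℓ∓1)`, Manin constant prime to `p`, `L(E,1) ≠ 0`: if SOME Kurihara number
`δ_n` is a `p`-adic unit then `ord_p #Ш(E) = ord_p (L(E,1)/Ω_E)`, in particular the LOWER half
`Typed.MissingLowerBoundAt W p`. `ms` is the plus modular symbol of the newform of `E` w.r.t. the real
Néron period (`Re {∞, r}_f = [r]⁺ · Ω⁺`); `δ ≠ 0` guards the junk value `padicValRat p 0 = 0`. -/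
def KimNakamuraToLowerHalf : Prop :=
  ∀ (W : WeierstrassCurve ℚ) [W.IsElliptic] [W.IsGloballyMinimal] [NeZero (W.conductorNorm ℤ)]
    (p : ℕ) [Fact p.Prime] (Dt : ModularParametrizationData W (W.conductorNorm ℤ)) (ms : ℚ → ℚ),
    7 < p → Addv W p → W.HasSurjectiveModNGaloisRep p → ¬ p ∣ W.tamagawaProduct →
    (∀ (ℓ : ℕ) [Fact ℓ.Prime], W.HasMultiplicativeReductionAtPrime ℓ → ¬ p ∣ (ℓ - 1) * (ℓ + 1)) →
    ¬ (p : ℤ) ∣ Dt.c → W.analyticRank = 0 →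
    (∀ r : ℚ, (modularSymbol Dt.f r).re = (ms r : ℝ) * W.realPeriodRat) →
    (∃ (n : ℕ) (g : ℕ → ℕ) (dl : ℕ → ℕ → ℕ), IsKuriharaLevel W p n ∧ IsDiscreteLogSystem n g dl ∧
        kuriharaNumber ms n dl ≠ 0 ∧ padicValRat p (kuriharaNumber ms n dl) = 0) →
    MissingLowerBoundAt W p

/-- The RESIDUAL of the road to LOW₀ (Kurihara's non-vanishing conjecture on the additive rank-0 rows,
Kim–Nakamura Rem. 1.8(2)): every such row has a unit Kurihara number. Stated, not asserted; decidable
row by row by an exact modular-symbol computation. -/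
def KuriharaNonvanishingRankZeroAdditive : Prop :=
  ∀ (W : WeierstrassCurve ℚ) [W.IsElliptic] [W.IsGloballyMinimal] [NeZero (W.conductorNorm ℤ)]
    (p : ℕ) [Fact p.Prime] (Dt : ModularParametrizationData W (W.conductorNorm ℤ)) (ms : ℚ → ℚ),
    5 ≤ p → ¬ W.HasCM → Addv W p → W.HasSurjectiveModNGaloisRep p → W.analyticRank = 0 →
    (∀ r : ℚ, (modularSymbol Dt.f r).re = (ms r : ℝ) * W.realPeriodRat) →
    ∃ (n : ℕ) (g : ℕ → ℕ) (dl : ℕ → ℕ → ℕ), IsKuriharaLevel W p n ∧ IsDiscreteLogSystem n g dl ∧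
        kuriharaNumber ms n dl ≠ 0 ∧ padicValRat p (kuriharaNumber ms n dl) = 0

end KuriharaLowerHalf

/-! ## §3 Division-algebra type slot -/
namespace DivisionTypeSlot

/-- FIRST LEMMA (card `division-type-slot`): arithmetic of the depth-zero slot. For the supercuspidal
cells (`e ∈ {3,4,6}`, `e ∤ p − 1`) the order-`e` character `θ = γ^{(p²−1)/e}` of `𝔽_{p²}ˣ = ⟨γ⟩`
(i) exists (`e ∣ p + 1 ∣ p² − 1`), (ii) is trivial on `𝔽_pˣ =` the `(p+1)`-th powers, (iii) is REGULAR
(`θ^p ≠ θ`, i.e. `θ^{p−1} ≠ 1`), and (iv) the level group `O_D^× / (1 + Π O_D) ≅ 𝔽_{p²}ˣ` is a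
`p′`-group, so the `θ`-idempotent is `p`-integral. Elementary; decidable for each `p`. -/
def SlotArithmetic : Prop :=
  ∀ p e : ℕ, p.Prime → 5 ≤ p → (e = 3 ∨ e = 4 ∨ e = 6) → ¬ e ∣ p - 1 →
    e ∣ p + 1 ∧ e ∣ p ^ 2 - 1 ∧
    (p ^ 2 - 1) ∣ (p + 1) * ((p ^ 2 - 1) / e) ∧
    ¬ (p ^ 2 - 1) ∣ (p - 1) * ((p ^ 2 - 1) / e) ∧
    Nat.Coprime p (p ^ 2 - 1)

/-- Sanity instance of `SlotArithmetic` at `(p, e) = (5, 3)` (the `(5, IV / IV*)` cells), by `decide`. -/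
theorem slotArithmetic_five_three :
    3 ∣ 5 + 1 ∧ 3 ∣ 5 ^ 2 - 1 ∧ (5 ^ 2 - 1) ∣ (5 + 1) * ((5 ^ 2 - 1) / 3) ∧
    ¬ (5 ^ 2 - 1) ∣ (5 - 1) * ((5 ^ 2 - 1) / 3) ∧ Nat.Coprime 5 (5 ^ 2 - 1) := by decide

/-- … and at `(p, e) = (7, 4)` (the `(7, III / III*)` cells). -/
theorem slotArithmetic_seven_four :
    4 ∣ 7 + 1 ∧ 4 ∣ 7 ^ 2 - 1 ∧ (7 ^ 2 - 1) ∣ (7 + 1) * ((7 ^ 2 - 1) / 4) ∧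
    ¬ (7 ^ 2 - 1) ∣ (7 - 1) * ((7 ^ 2 - 1) / 4) ∧ Nat.Coprime 7 (7 ^ 2 - 1) := by decide

end DivisionTypeSlot

end Summit.BirchSwinnertonDyer.BirchSwinnertonDyer.Cruxes.LevelKolyvaginSystemsAdditive

end
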